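import Summits.Ventures.Crystal3D.Theorems.StickyWulffConstantStackingLiminfTwelveSlots
import HarnessLib

/-!
# Grid boundary of a Barlow configuration (rung R9 transfer, line `LayerChain` v4, crux
# `StackingLiminf`, stmt-Ventures-19145): the six INDEX moves are six of the twelve bonds, so every
# directed grid-boundary count is at most `12 N − 2·numContacts`

Route `StickyWulffConstant` of the venture `Summits/Ventures/Crystal3D` (cell `crystal3d-full`).
A configuration `x` inside `barlowStacking 1 √(2/3) σ` (Hägg word `σ`) is indexed by lattice triples
`idx i = (k, i, j)` with `x i = barlowPos 1 √(2/3) σ k i j`.  In INDEX space `ℤ³` the six unit moves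
`(0,±1,0)`, `(0,0,±1)`, `(±1,0,0)` are realised by the bond vectors `±aVec 0`, `±aVec 1`,
`+b_{σ k, 0}`, `−b_{σ (k−1), 0}` of `…TwelveVectors` (`barlowPos_idx_add_unit`), i.e. they are six of
the twelve neighbour slots of `…TwelveSlots` (wulff-p2, p510328).  Hence for every unit step `u`:
`#{a ∈ idx(X) : a + u ∉ idx(X)} + 2·numContacts x ≤ 12 N` (**`card_grid_boundary_add_le`**), the
boundary input `M ≤ 2D` of the generic pair count `card_pairs_le` (`…GridPairCount`) in the bad-mass
step of stub (C) `stub_plateauBound`.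
WHAT THIS IS NOT: not the pair count in real space yet; rung F-C1 not moved.
-/

noncomputable section

namespace Summit.Ventures.Crystal3D.Theorems.PlateauHeight

open Finset
open Literature.MathematicalPhysics.StatisticalMechanics
open Summit.Ventures.Crystal3D.LayerChain (aVec bPlus bMinus)

/-- The bond vector realising the index move `u` (`‖u‖₁ = 1`) from layer `k` of the word `σ`. -/
theorem barlowPos_idx_add_unit {σ : ℤ → ℤ} (hσ : IsHaggSeq σ) (k i j : ℤ) (u : ℤ × ℤ × ℤ)
    (hu : |u.1| + |u.2.1| + |u.2.2| = 1) :
    ∃ v : Fin 3 → ℝ,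
      (v = aVec 0 ∨ v = -aVec 0 ∨ v = aVec 1 ∨ v = -aVec 1 ∨
        v = (if σ k = 1 then bPlus 0 else bMinus 0) ∨
        v = -(if σ (k - 1) = 1 then bPlus 0 else bMinus 0)) ∧
      barlowPos 1 (Real.sqrt (2 / 3)) σ (k + u.1) (i + u.2.1) (j + u.2.2) =
        barlowPos 1 (Real.sqrt (2 / 3)) σ k i j + WithLp.toLp 2 v := by
  obtain ⟨p, q, r⟩ := u
  simp only at hu ⊢
  -- the six cases
  have habs : ∀ z : ℤ, 0 ≤ |z| := fun z => abs_nonneg z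
  have hcases : (p = 1 ∧ q = 0 ∧ r = 0) ∨ (p = -1 ∧ q = 0 ∧ r = 0) ∨ (p = 0 ∧ q = 1 ∧ r = 0) ∨
      (p = 0 ∧ q = -1 ∧ r = 0) ∨ (p = 0 ∧ q = 0 ∧ r = 1) ∨ (p = 0 ∧ q = 0 ∧ r = -1) := by
    rcases le_or_gt 0 p with hp | hp <;> rcases le_or_gt 0 q with hq | hq <;>
      rcases le_or_gt 0 r with hr | hr <;>
      simp only [abs_of_nonneg, abs_of_neg, hp, hq, hr] at hu <;> omega
  rcases hcases with ⟨rfl, rfl, rfl⟩ | ⟨rfl, rfl, rfl⟩ | ⟨rfl, rfl, rfl⟩ | ⟨rfl, rfl, rfl⟩ |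
      ⟨rfl, rfl, rfl⟩ | ⟨rfl, rfl, rfl⟩
  · -- one layer up: `+ b_{σ k, 0}`
    refine ⟨if σ k = 1 then bPlus 0 else bMinus 0, by simp, ?_⟩
    rcases hσ k with h1 | h1
    · simp only [h1, if_true]
      ext l
      fin_cases l <;> simp [bPlus, haggLabel_succ, h1] <;> ring
    · have hne : σ k ≠ 1 := by rw [h1]; norm_num
      simp only [hne, if_false]
      ext l
      fin_cases l <;> simp [bMinus, haggLabel_succ, h1] <;> ring
  · -- one layer down: `− b_{σ (k−1), 0}`
    refine ⟨-(if σ (k - 1) = 1 then bPlus 0 else bMinus 0), by simp, ?_⟩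
    have hL : (haggLabel σ (k + -1) : ℝ) = haggLabel σ k - σ (k - 1) := by
      have := haggLabel_succ (s := σ) (k - 1)
      rw [sub_add_cancel] at this
      rw [← sub_eq_add_neg, this]; push_cast; ring
    rcases hσ (k - 1) with h1 | h1
    · simp only [h1, if_true]
      ext l
      fin_cases l <;> simp [bPlus, hL, h1] <;> ring
    · have hne : σ (k - 1) ≠ 1 := by rw [h1]; norm_num
      simp only [hne, if_false]
      ext l
      fin_cases l <;> simp [bMinus, hL, h1] <;> ring
  · refine ⟨aVec 0, by simp, ?_⟩
    ext l
    fin_cases l <;> simp [aVec]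
    ring
  · refine ⟨-aVec 0, by simp, ?_⟩
    ext l
    fin_cases l <;> simp [aVec]
    ring
  · refine ⟨aVec 1, by simp, ?_⟩
    ext l
    fin_cases l <;> simp [aVec] <;> ring
  · refine ⟨-aVec 1, by simp, ?_⟩
    ext l
    fin_cases l <;> simp [aVec] <;> ring

/-- `barlowPos 1 √(2/3) σ` is injective on index triples. -/
theorem barlowPos_idx_injective (σ : ℤ → ℤ) {k i j k' i' j' : ℤ}
    (h : barlowPos 1 (Real.sqrt (2 / 3)) σ k i j = barlowPos 1 (Real.sqrt (2 / 3)) σ k' i' j') :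
    (k, i, j) = (k', i', j') := by
  by_contra hne
  have hd := le_dist_barlowPos (a := (1 : ℝ)) (h := Real.sqrt (2 / 3)) (s := σ) zero_le_one
    (Real.sqrt_nonneg _) (k := k) (i := i) (j := j) (k' := k') (i' := i') (j' := j') hne
  rw [h, dist_self] at hd
  have : (0 : ℝ) < min 1 (Real.sqrt (2 / 3)) := lt_min one_pos (Real.sqrt_pos.2 (by norm_num))
  linarith

open scoped Classical in
/-- **Grid boundary ≤ total vacancy count.**  For a Hägg word `σ`, an injective configuration `x`
in `barlowStacking 1 √(2/3) σ` with index map `idx`, and any unit index step `u`: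
`#{a ∈ idx(X) : a + u ∉ idx(X)} + 2 · numContacts x ≤ 12 N`. -/
theorem card_grid_boundary_add_le {σ : ℤ → ℤ} (hσ : IsHaggSeq σ) {N : ℕ}
    (x : Fin N → EuclideanSpace ℝ (Fin 3)) (hx : Function.Injective x)
    (hmem : ∀ i, x i ∈ barlowStacking 1 (Real.sqrt (2 / 3)) σ) (idx : Fin N → ℤ × ℤ × ℤ)
    (hidx : ∀ i, x i = barlowPos 1 (Real.sqrt (2 / 3)) σ (idx i).1 (idx i).2.1 (idx i).2.2)
    (u : ℤ × ℤ × ℤ) (hu : |u.1| + |u.2.1| + |u.2.2| = 1) :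
    ((univ.image idx).filter fun a => a + u ∉ univ.image idx).card +
      2 * Summit.Ventures.Crystal3D.numContacts x ≤ 12 * N := by
  -- layer indices
  have hkf : ∀ i, x i 2 = ((idx i).1 : ℝ) * Real.sqrt (2 / 3) := fun i => by
    rw [hidx i, barlowPos_apply_two]
  have h12 := sum_vacant_add_two_mul_numContacts hσ x hx hmem (fun i => (idx i).1) hkf
  rw [← h12]
  refine Nat.add_le_add_right ?_ _
  -- the boundary set is the image under `idx` of the balls whose `u`-slot is vacant
  have hidx_inj : Function.Injective idx := by
    intro a b hab
    apply hx
    rw [hidx a, hidx b, hab]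
  -- count over balls
  have hle : ((univ.image idx).filter fun a => a + u ∉ univ.image idx).card ≤
      (univ.filter fun i : Fin N => idx i + u ∉ univ.image idx).card := by
    rw [filter_image, card_image_of_injective _ hidx_inj]
  refine hle.trans ?_
  rw [card_eq_sum_ones]
  refine le_trans (sum_le_sum fun i hi => ?_) (sum_le_univ_sum_of_nonneg fun _ => Nat.zero_le _)
  -- ball `i`'s `u`-slot is vacant: exhibit it in the filtered twelve-slot set
  rw [mem_filter] at hi
  obtain ⟨v, hv, hpos⟩ := barlowPos_idx_add_unit hσ (idx i).1 (idx i).2.1 (idx i).2.2 u hu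
  rw [← hidx i] at hpos
  -- the slot position is vacant
  have hvac : x i + WithLp.toLp 2 v ∉ Set.range x := by
    rintro ⟨i', hi'⟩
    apply hi.2
    rw [mem_image]
    refine ⟨i', mem_univ _, ?_⟩
    have h3 := barlowPos_idx_injective σ (hpos.trans (hi'.symm.trans (hidx i')))
    simp only [Prod.mk.injEq] at h3
    rw [Prod.ext_iff, Prod.ext_iff]
    simp only [Prod.fst_add, Prod.snd_add]
    exact ⟨h3.1.symm, h3.2.1.symm, h3.2.2.symm⟩
  refine Nat.one_le_iff_ne_zero.2 (card_ne_zero.2 ⟨x i + WithLp.toLp 2 v, ?_⟩)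
  rw [mem_filter]
  refine ⟨?_, hvac⟩
  -- membership in the twelve-slot set
  simp only [mem_union, mem_image, mem_univ, true_and]
  rcases hv with rfl | rfl | rfl | rfl | rfl | rfl
  · exact Or.inl (Or.inl (Or.inl ⟨0, rfl⟩))
  · exact Or.inl (Or.inl (Or.inr ⟨0, by rw [WithLp.toLp_neg, sub_eq_add_neg]⟩))
  · exact Or.inl (Or.inl (Or.inl ⟨1, rfl⟩))
  · exact Or.inl (Or.inl (Or.inr ⟨1, by rw [WithLp.toLp_neg, sub_eq_add_neg]⟩))
  · exact Or.inl (Or.inr ⟨0, rfl⟩)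
  · exact Or.inr ⟨0, by rw [WithLp.toLp_neg, sub_eq_add_neg]⟩

end Summit.Ventures.Crystal3D.Theorems.PlateauHeight

end
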